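import Summits.AtomisticToContinuum.FouriersLaw.Theorems.EmbeddedDrudeMourreFGRGapEssGapB

/-!
# `FGRGap`, line fold-jet-rigidity, stub `stub_oddEssentialGap` — part D: cross terms through a chart

Helper file for the crux `Summit.AtomisticToContinuum.FouriersLaw.Theses.EmbeddedDrudeMourre.FGRGap`
(item `stmt-AtomisticToContinuum-12595`), registered stub `stub_oddEssentialGap` (sequel of parts A, B).

ABSTRACT SETTING (no band geometry): a chart `e : OpenPartialHomeomorph (ℝ × ℝ) (ℝ × ℝ)`, a compact
measurable set `R ⊆ e.source` on which `e` has derivative `D p` within `R` with `|det D p| ≥ δ > 0`, and a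
weight `W` continuous on `R`.  In the proof of the odd essential gap, `e` is one of the coordinate-pair
charts `p ↦ (k₁, φ p)` or `p ↦ (k₁, k₁ + φ p - k₃)` of a general-position rectangle `R`, `φ` an analytic
lift of the partner map, and `W(p) = w(k₁, φ p, k₃)` the collision weight.

* `setIntegral_chart_eq_kernel_form`: `∫_R W·(g₁∘e₁)(g₂∘e₂) = ∫_{ℝ²} K(q) g₁(q₁) g₂(q₂) dq` with the
  pushed-forward kernel `K = 𝟙_{e(R)} · (W/|det D|) ∘ e⁻¹` (change of variables
  `integral_image_eq_integral_abs_det_fderiv_smul`); `K` is measurable (continuous on the compact `e(R)`),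
  bounded by `Wmax/δ`, and vanishes off `e(R)`;
* `lintegral_chart_sq_snd_le` / `…_fst_le`: `∫⁻_R g(e p)_i² ≤ δ⁻¹ · |window|·(2N+1)` for `2π`-periodic `g`
  with `‖g‖²_{cell} ≤ 1` whenever `e(R) ⊆ window × window` (lower-integral change of variables + part A);
* `tendsto_setIntegral_chart`: along a weakly-null sequence of periodic unit vectors,
  `∫_R W·(g_n∘e₁)(g_n∘e₂) → 0` (kernel form + the kernel lemma of part B).

Folklore; no named facts.
-/

noncomputable section

open MeasureTheory Set Real Filter Topology
open scoped ENNReal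
open Literature.MathematicalPhysics.KineticTheory.PhononBoltzmann

namespace Summit.AtomisticToContinuum.FouriersLaw.Theorems.FGRGap.FoldJetRigidity.EssGap

variable {e : OpenPartialHomeomorph (ℝ × ℝ) (ℝ × ℝ)} {R : Set (ℝ × ℝ)}
  {D : ℝ × ℝ → (ℝ × ℝ →L[ℝ] ℝ × ℝ)} {W : ℝ × ℝ → ℝ} {δ Wmax : ℝ}

/-! ## 1. The pushed-forward kernel -/

/-- The kernel vanishes off `e(R)`. [folklore] -/
theorem kernel_eq_zero {q : ℝ × ℝ} (hq : q ∉ e '' R) :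
    (e '' R).indicator (fun q => W (e.symm q) / |(D (e.symm q)).det|) q = 0 :=
  indicator_of_notMem hq _

/-- The kernel at an image point: `K(e p) = W p / |det D p|` for `p ∈ R ⊆ e.source`. [folklore] -/
theorem kernel_apply_image (hRs : R ⊆ e.source) {p : ℝ × ℝ} (hp : p ∈ R) :
    (e '' R).indicator (fun q => W (e.symm q) / |(D (e.symm q)).det|) (e p) = W p / |(D p).det| := by
  rw [indicator_of_mem (mem_image_of_mem e hp), e.left_inv (hRs hp)]

/-- The kernel is bounded by `Wmax / δ` (`Wmax ≥ 0`). [folklore] -/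
theorem abs_kernel_le (hRs : R ⊆ e.source) (hδ : 0 < δ) (hdet : ∀ p ∈ R, δ ≤ |(D p).det|)
    (hW0 : 0 ≤ Wmax) (hWb : ∀ p ∈ R, |W p| ≤ Wmax) (q : ℝ × ℝ) :
    |(e '' R).indicator (fun q => W (e.symm q) / |(D (e.symm q)).det|) q| ≤ Wmax / δ := by
  by_cases hq : q ∈ e '' R
  · obtain ⟨p, hp, rfl⟩ := hq
    rw [kernel_apply_image hRs hp, abs_div, abs_abs]
    have hd : 0 < |(D p).det| := lt_of_lt_of_le hδ (hdet p hp)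
    rw [div_le_div_iff₀ hd hδ]
    exact mul_le_mul (hWb p hp) (hdet p hp) hδ.le hW0
  · rw [kernel_eq_zero hq, abs_zero]
    exact div_nonneg hW0 hδ.le

/-- The kernel is measurable (continuous on the compact image `e(R)`, zero outside). [folklore] -/
theorem measurable_kernel (hR : IsCompact R) (hRs : R ⊆ e.source) (hW : ContinuousOn W R)
    (hDc : ContinuousOn (fun p => (D p).det) R) (hdet : ∀ p ∈ R, (D p).det ≠ 0) :
    Measurable ((e '' R).indicator (fun q => W (e.symm q) / |(D (e.symm q)).det|)) := by
  classical
  have himg : IsCompact (e '' R) := hR.image_of_continuousOn (e.continuousOn.mono hRs)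
  have hmaps : MapsTo e.symm (e '' R) R := by
    rintro _ ⟨p, hp, rfl⟩; rw [e.left_inv (hRs hp)]; exact hp
  have hsymm : ContinuousOn e.symm (e '' R) :=
    e.continuousOn_symm.mono (by rintro _ ⟨p, hp, rfl⟩; exact e.map_source (hRs hp))
  have hf : ContinuousOn (fun q => W (e.symm q) / |(D (e.symm q)).det|) (e '' R) := by
    refine ContinuousOn.div (hW.comp hsymm hmaps) ((hDc.comp hsymm hmaps).abs) ?_
    rintro _ ⟨p, hp, rfl⟩
    rw [e.left_inv (hRs hp)]
    exact abs_ne_zero.mpr (hdet p hp)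
  rw [← piecewise_eq_indicator]
  exact hf.measurable_piecewise continuousOn_const himg.isClosed.measurableSet

/-! ## 2. The cross term in kernel form -/

/-- **Change of variables for a cross term**: with `K = 𝟙_{e(R)}·(W/|det D|)∘e⁻¹`,
`∫_R W(p) g₁((e p)₁) g₂((e p)₂) dp = ∫ K(q) g₁(q₁) g₂(q₂) dq`. [folklore] -/
theorem setIntegral_chart_eq_kernel_form (hRm : MeasurableSet R) (hRs : R ⊆ e.source)
    (hderiv : ∀ p ∈ R, HasFDerivWithinAt e (D p) R p) (hdet : ∀ p ∈ R, (D p).det ≠ 0)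
    (g₁ g₂ : ℝ → ℝ) :
    ∫ p in R, W p * (g₁ (e p).1 * g₂ (e p).2) =
      ∫ q, (e '' R).indicator (fun q => W (e.symm q) / |(D (e.symm q)).det|) q * (g₁ q.1 * g₂ q.2) := by
  have hinj : InjOn e R := e.injOn.mono hRs
  have hcv := integral_image_eq_integral_abs_det_fderiv_smul volume hRm hderiv hinj
    (fun q => (e '' R).indicator (fun q => W (e.symm q) / |(D (e.symm q)).det|) q * (g₁ q.1 * g₂ q.2))
  calc ∫ p in R, W p * (g₁ (e p).1 * g₂ (e p).2)
      = ∫ p in R, |(D p).det| • ((e '' R).indicator (fun q => W (e.symm q) / |(D (e.symm q)).det|) (e p) *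
          (g₁ (e p).1 * g₂ (e p).2)) := by
        refine setIntegral_congr_fun hRm fun p hp => ?_
        rw [kernel_apply_image hRs hp, smul_eq_mul]
        have hd : |(D p).det| ≠ 0 := abs_ne_zero.mpr (hdet p hp)
        field_simp
    _ = ∫ q in e '' R, (e '' R).indicator (fun q => W (e.symm q) / |(D (e.symm q)).det|) q *
          (g₁ q.1 * g₂ q.2) := hcv.symm
    _ = _ := setIntegral_eq_integral_of_forall_compl_eq_zero fun q hq => by
        rw [kernel_eq_zero hq, zero_mul]

/-! ## 3. `L²` bounds of pulled-back coordinates -/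

/-- Square integrals of a coordinate over a window square. [folklore] -/
theorem lintegral_sq_snd_window_sq_le {g : ℝ → ℝ} (hg : Function.Periodic g (2 * π)) (hg1 : cellNormSq g ≤ 1)
    (N : ℕ) :
    ∫⁻ q in Ioc (-π - N * (2 * π)) (π + N * (2 * π)) ×ˢ Ioc (-π - N * (2 * π)) (π + N * (2 * π)),
        ENNReal.ofReal (g q.2 ^ 2) ∂(volume.prod volume) ≤
      ENNReal.ofReal ((2 * N + 1) * (2 * π)) * (2 * N + 1) := by
  rw [← Measure.prod_restrict]
  refine (lintegral_prod_le _).trans ?_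
  have hin : ∫⁻ y in Ioc (-π - N * (2 * π)) (π + N * (2 * π)), ENNReal.ofReal (g y ^ 2) ≤ 2 * N + 1 :=
    (lintegral_sq_window_le hg N).trans (by simpa using (mul_le_mul' le_rfl hg1 :
      (2 * N + 1 : ℝ≥0∞) * cellNormSq g ≤ (2 * N + 1) * 1))
  calc ∫⁻ _ in Ioc (-π - N * (2 * π)) (π + N * (2 * π)),
          ∫⁻ y in Ioc (-π - N * (2 * π)) (π + N * (2 * π)), ENNReal.ofReal (g y ^ 2)
      ≤ ∫⁻ _ in Ioc (-π - N * (2 * π)) (π + N * (2 * π)), (2 * N + 1 : ℝ≥0∞) := lintegral_mono fun _ => hin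
    _ = ENNReal.ofReal ((2 * N + 1) * (2 * π)) * (2 * N + 1) := by
        rw [setLIntegral_const, Real.volume_Ioc, mul_comm]
        congr 1; congr 1; ring

/-- Same for the first coordinate. [folklore] -/
theorem lintegral_sq_fst_window_sq_le {g : ℝ → ℝ} (hg : Function.Periodic g (2 * π)) (hg1 : cellNormSq g ≤ 1)
    (N : ℕ) :
    ∫⁻ q in Ioc (-π - N * (2 * π)) (π + N * (2 * π)) ×ˢ Ioc (-π - N * (2 * π)) (π + N * (2 * π)),
        ENNReal.ofReal (g q.1 ^ 2) ∂(volume.prod volume) ≤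
      ENNReal.ofReal ((2 * N + 1) * (2 * π)) * (2 * N + 1) := by
  rw [← Measure.prod_restrict]
  refine (lintegral_prod_le _).trans ?_
  have hin : ∫⁻ x in Ioc (-π - N * (2 * π)) (π + N * (2 * π)), ENNReal.ofReal (g x ^ 2) ≤ 2 * N + 1 :=
    (lintegral_sq_window_le hg N).trans (by simpa using (mul_le_mul' le_rfl hg1 :
      (2 * N + 1 : ℝ≥0∞) * cellNormSq g ≤ (2 * N + 1) * 1))
  calc ∫⁻ x in Ioc (-π - N * (2 * π)) (π + N * (2 * π)),
          ∫⁻ _ in Ioc (-π - N * (2 * π)) (π + N * (2 * π)), ENNReal.ofReal (g x ^ 2)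
      = ∫⁻ x in Ioc (-π - N * (2 * π)) (π + N * (2 * π)),
          ENNReal.ofReal (g x ^ 2) * volume (Ioc (-π - N * (2 * π)) (π + N * (2 * π))) := by
        apply lintegral_congr; intro x
        rw [setLIntegral_const, mul_comm]
    _ ≤ (2 * N + 1) * volume (Ioc (-π - N * (2 * π)) (π + N * (2 * π))) := by
        rw [lintegral_mul_const' _ _ measure_Ioc_lt_top.ne]
        exact mul_le_mul' hin le_rfl
    _ = ENNReal.ofReal ((2 * N + 1) * (2 * π)) * (2 * N + 1) := by
        rw [Real.volume_Ioc, mul_comm]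
        congr 1; congr 1; ring

/-- **`L²` bound of the second chart coordinate on `R`**: if `e(R) ⊆ window²` and `|det D| ≥ δ > 0` on
`R`, then `∫⁻_R g((e p)₂)² ≤ δ⁻¹·|window|·(2N+1)` for `2π`-periodic `g` with `‖g‖²_{cell} ≤ 1`. [folklore] -/
theorem lintegral_chart_sq_snd_le (hRm : MeasurableSet R) (hRs : R ⊆ e.source)
    (hderiv : ∀ p ∈ R, HasFDerivWithinAt e (D p) R p) (hδ : 0 < δ) (hdet : ∀ p ∈ R, δ ≤ |(D p).det|)
    (N : ℕ) (hsub : e '' R ⊆ Ioc (-π - N * (2 * π)) (π + N * (2 * π)) ×ˢ Ioc (-π - N * (2 * π)) (π + N * (2 * π)))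
    {g : ℝ → ℝ} (hg : Function.Periodic g (2 * π)) (hg1 : cellNormSq g ≤ 1) :
    ∫⁻ p in R, ENNReal.ofReal (g (e p).2 ^ 2) ≤
      (ENNReal.ofReal δ)⁻¹ * (ENNReal.ofReal ((2 * N + 1) * (2 * π)) * (2 * N + 1)) := by
  have hinj : InjOn e R := e.injOn.mono hRs
  have hcv := lintegral_image_eq_lintegral_abs_det_fderiv_mul volume hRm hderiv hinj
    (fun q => ENNReal.ofReal (g q.2 ^ 2))
  have h1 : ENNReal.ofReal δ * ∫⁻ p in R, ENNReal.ofReal (g (e p).2 ^ 2) ≤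
      ∫⁻ q in e '' R, ENNReal.ofReal (g q.2 ^ 2) := by
    rw [hcv, ← lintegral_const_mul' _ _ ENNReal.ofReal_ne_top]
    refine setLIntegral_mono' hRm fun p hp => ?_
    exact mul_le_mul' (ENNReal.ofReal_le_ofReal (hdet p hp)) le_rfl
  have h2 : ∫⁻ q in e '' R, ENNReal.ofReal (g q.2 ^ 2) ≤ ENNReal.ofReal ((2 * N + 1) * (2 * π)) * (2 * N + 1) := by
    refine (lintegral_mono_set hsub).trans ?_
    rw [Measure.volume_eq_prod]
    exact lintegral_sq_snd_window_sq_le hg hg1 N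
  have hδ' : ENNReal.ofReal δ ≠ 0 := (ENNReal.ofReal_pos.mpr hδ).ne'
  calc ∫⁻ p in R, ENNReal.ofReal (g (e p).2 ^ 2)
      = (ENNReal.ofReal δ)⁻¹ * (ENNReal.ofReal δ * ∫⁻ p in R, ENNReal.ofReal (g (e p).2 ^ 2)) := by
        rw [← mul_assoc, ENNReal.inv_mul_cancel hδ' ENNReal.ofReal_ne_top, one_mul]
    _ ≤ (ENNReal.ofReal δ)⁻¹ * (ENNReal.ofReal ((2 * N + 1) * (2 * π)) * (2 * N + 1)) := by
        exact mul_le_mul' le_rfl (h1.trans h2)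

/-- **`L²` bound of the first chart coordinate on `R`.** [folklore] -/
theorem lintegral_chart_sq_fst_le (hRm : MeasurableSet R) (hRs : R ⊆ e.source)
    (hderiv : ∀ p ∈ R, HasFDerivWithinAt e (D p) R p) (hδ : 0 < δ) (hdet : ∀ p ∈ R, δ ≤ |(D p).det|)
    (N : ℕ) (hsub : e '' R ⊆ Ioc (-π - N * (2 * π)) (π + N * (2 * π)) ×ˢ Ioc (-π - N * (2 * π)) (π + N * (2 * π)))
    {g : ℝ → ℝ} (hg : Function.Periodic g (2 * π)) (hg1 : cellNormSq g ≤ 1) :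
    ∫⁻ p in R, ENNReal.ofReal (g (e p).1 ^ 2) ≤
      (ENNReal.ofReal δ)⁻¹ * (ENNReal.ofReal ((2 * N + 1) * (2 * π)) * (2 * N + 1)) := by
  have hinj : InjOn e R := e.injOn.mono hRs
  have hcv := lintegral_image_eq_lintegral_abs_det_fderiv_mul volume hRm hderiv hinj
    (fun q => ENNReal.ofReal (g q.1 ^ 2))
  have h1 : ENNReal.ofReal δ * ∫⁻ p in R, ENNReal.ofReal (g (e p).1 ^ 2) ≤
      ∫⁻ q in e '' R, ENNReal.ofReal (g q.1 ^ 2) := by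
    rw [hcv, ← lintegral_const_mul' _ _ ENNReal.ofReal_ne_top]
    refine setLIntegral_mono' hRm fun p hp => ?_
    exact mul_le_mul' (ENNReal.ofReal_le_ofReal (hdet p hp)) le_rfl
  have h2 : ∫⁻ q in e '' R, ENNReal.ofReal (g q.1 ^ 2) ≤ ENNReal.ofReal ((2 * N + 1) * (2 * π)) * (2 * N + 1) := by
    refine (lintegral_mono_set hsub).trans ?_
    rw [Measure.volume_eq_prod]
    exact lintegral_sq_fst_window_sq_le hg hg1 N
  have hδ' : ENNReal.ofReal δ ≠ 0 := (ENNReal.ofReal_pos.mpr hδ).ne'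
  calc ∫⁻ p in R, ENNReal.ofReal (g (e p).1 ^ 2)
      = (ENNReal.ofReal δ)⁻¹ * (ENNReal.ofReal δ * ∫⁻ p in R, ENNReal.ofReal (g (e p).1 ^ 2)) := by
        rw [← mul_assoc, ENNReal.inv_mul_cancel hδ' ENNReal.ofReal_ne_top, one_mul]
    _ ≤ (ENNReal.ofReal δ)⁻¹ * (ENNReal.ofReal ((2 * N + 1) * (2 * π)) * (2 * N + 1)) := by
        exact mul_le_mul' le_rfl (h1.trans h2)

/-! ## 4. Cross terms die along weakly-null sequences -/

/-- **Cross terms through a chart die along weakly-null sequences.** [folklore] -/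
theorem tendsto_setIntegral_chart (hR : IsCompact R) (hRm : MeasurableSet R) (hRs : R ⊆ e.source)
    (hderiv : ∀ p ∈ R, HasFDerivWithinAt e (D p) R p) (hδ : 0 < δ) (hdet : ∀ p ∈ R, δ ≤ |(D p).det|)
    (hDc : ContinuousOn (fun p => (D p).det) R) (hW : ContinuousOn W R) (hW0 : 0 ≤ Wmax)
    (hWb : ∀ p ∈ R, |W p| ≤ Wmax)
    (N : ℕ) (hsub : e '' R ⊆ Ioc (-π - N * (2 * π)) (π + N * (2 * π)) ×ˢ Ioc (-π - N * (2 * π)) (π + N * (2 * π)))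
    {g : ℕ → ℝ → ℝ} (hper : ∀ n, Function.Periodic (g n) (2 * π)) (hgm : ∀ n, Measurable (g n))
    (hg1 : ∀ n, cellNormSq (g n) ≤ 1)
    (hweak : ∀ φ : ℝ → ℝ, Measurable φ → cellNormSq φ < ∞ →
      Tendsto (fun n => cellPairing φ (g n)) atTop (𝓝 0)) :
    Tendsto (fun n => ∫ p in R, W p * (g n (e p).1 * g n (e p).2)) atTop (𝓝 0) := by
  have hdet0 : ∀ p ∈ R, (D p).det ≠ 0 := fun p hp =>
    abs_ne_zero.mp (lt_of_lt_of_le hδ (hdet p hp)).ne'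
  simp_rw [setIntegral_chart_eq_kernel_form hRm hRs hderiv hdet0]
  exact tendsto_kernel_form_of_weaklyNull (measurable_kernel hR hRs hW hDc hdet0) N
    (abs_kernel_le hRs hδ hdet hW0 hWb) (fun q hq => kernel_eq_zero fun h => hq (hsub h)) hper hgm hg1 hweak

end Summit.AtomisticToContinuum.FouriersLaw.Theorems.FGRGap.FoldJetRigidity.EssGap

namespace Summit.AtomisticToContinuum.FouriersLaw.Theorems.FGRGap.FoldJetRigidity

/-- REGISTERED HELPER STUB `stub_oddEssentialGap_partD` (landing vehicle of this file): abstract chart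
integrals ∫_R W·g(e p)₁·g(e p)₂ are kernel forms and die along weakly-null sequences; window-square
L² bounds of pulled-back coordinates. [folklore] -/
theorem stub_oddEssentialGap_partD :
    ∀ (g : ℝ → ℝ) (N : ℕ), Function.Periodic g (2 * π) → cellNormSq g ≤ 1 →
      ∫⁻ q in Set.Ioc (-π - N * (2 * π)) (π + N * (2 * π)) ×ˢ Set.Ioc (-π - N * (2 * π)) (π + N * (2 * π)),
          ENNReal.ofReal (g q.2 ^ 2) ∂(MeasureTheory.volume.prod MeasureTheory.volume) ≤
        ENNReal.ofReal ((2 * N + 1) * (2 * π)) * (2 * N + 1) :=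
  fun _g N hg hg1 => EssGap.lintegral_sq_snd_window_sq_le hg hg1 N

end Summit.AtomisticToContinuum.FouriersLaw.Theorems.FGRGap.FoldJetRigidity

end
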